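import Summits.ResolutionOfSingularities.ResolutionOfSingularities.Theorems.ValuativeLupiLaurentBase
import Literature.AlgebraicGeometry.Resolution.AdicCompletionRegular
import Literature.AlgebraicGeometry.Resolution.JacobianRegularLocus
import Literature.AlgebraicGeometry.Resolution.ResolutionLU
import HarnessLib

/-!
# Route `Valuative`, item `Lupi` (stmt-ResolutionOfSingularities-0560): local uniformization ascends along purely transcendental extensions

Two structural facts behind the reduction of `Lupi` "the polynomial `f` in `t ^ p = f(x)` may
be assumed to involve every variable" (`ValuativeLupiRestriction.lean`):

* `isRegularLocalRing_localization_mvPolynomial` — **regularity ascends along polynomial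
  extensions, prime by prime**: for a prime `Q` of `R[X_σ]` (`σ` finite) over `q = Q ∩ R`, if
  `R_q` is a regular local ring then so is `R[X_σ]_Q` — it is a localisation of `R_q[X_σ]`, which
  is a regular ring by Serre's theorem (`isRegularRing_of_isRegularLocalRing`, tree, Matsumura
  Thm. 19.3) and Mathlib's `MvPolynomial.isRegularRing_of_isRegularRing`; the localisation
  argument is Mathlib's `Polynomial.isRegularRing_of_isRegularRing`, verbatim.
* `isLocallyUniformizable_of_adjoin_model` — **local uniformization ascends along purely
  transcendental extensions**: if a finitely generated `k`-subalgebra `A₀ ⊆ O` of `K` is regular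
  at the centre of the valuation ring `O ⊇ k`, and `K = k(A₀, y₁, …, y_r)` with
  `trdeg_k A₀ + r ≤ trdeg_k K` (so that `y` is algebraically independent over `Frac A₀`), then
  `O` is locally uniformizable over `k`: the model is `A₀[y'] ≅ A₀[X₁, …, X_r]`, `y'ᵢ ∈ {yᵢ, yᵢ⁻¹}`
  adapted to `O` (the Laurent base of `ValuativeLupiLaurentBase` over the base RING `A₀`).

Log: (1) direct; Mathlib localisation API (`IsLocalization.isLocalization_isLocalization_atPrime_isLocalization`,
`IsLocalization.algEquiv`), `AlgebraicIndependent.aevalEquiv`, transcendence degree in towers.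
-/

-- single-problem summit: the doubled namespace component `ResolutionOfSingularities` is forced
set_option linter.dupNamespace false

open IsLocalRing

namespace Summit.ResolutionOfSingularities.ResolutionOfSingularities.Theorems.Lupi

open Literature.AlgebraicGeometry.Resolution

/-! ## Regularity of polynomial extensions at a prime over a regular prime -/

section PolynomialExtension

open MvPolynomial in
/-- **Regularity ascends along polynomial extensions, prime by prime.** For a commutative ring
`R`, finitely many variables `σ` and a prime `Q` of `R[X_σ]` lying over `q = Q ∩ R`: if `R_q` is a
regular local ring then so is `R[X_σ]_Q` (a localisation of the regular ring `R_q[X_σ]`: Serre's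
theorem `isRegularRing_of_isRegularLocalRing` and `MvPolynomial.isRegularRing_of_isRegularRing`;
cf. Mathlib's `Polynomial.isRegularLocalRing_localization_atPrime_of_comap_eq_maximalIdeal`, the
univariate case over the closed point). -/
theorem isRegularLocalRing_localization_mvPolynomial {R : Type*} [CommRing R] {σ : Type*}
    [Finite σ] (Q : Ideal (MvPolynomial σ R)) [Q.IsPrime]
    (hreg : IsRegularLocalRing
      (Localization.AtPrime (Q.comap (C : R →+* MvPolynomial σ R)))) :
    IsRegularLocalRing (Localization.AtPrime Q) := by
  set q : Ideal R := Q.comap (C : R →+* MvPolynomial σ R) with hq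
  let Rq := Localization.AtPrime q
  let S := MvPolynomial σ Rq
  let pc : Submonoid (MvPolynomial σ R) := q.primeCompl.map (C : R →+* MvPolynomial σ R)
  letI : Algebra (MvPolynomial σ R) S := MvPolynomial.algebraMvPolynomial
  haveI : IsLocalization pc S := MvPolynomial.isLocalization q.primeCompl Rq
  let QS : Ideal S := Q.map (algebraMap (MvPolynomial σ R) S)
  have disj : Disjoint (pc : Set (MvPolynomial σ R)) (Q : Set (MvPolynomial σ R)) := by
    rw [Set.disjoint_left]
    rintro _ ⟨r, hr, rfl⟩ hrQ
    exact hr hrQ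
  haveI hQS : QS.IsPrime := IsLocalization.isPrime_of_isPrime_disjoint pc S Q ‹_› disj
  haveI : IsLocalization.AtPrime (Localization.AtPrime QS) Q := by
    convert IsLocalization.isLocalization_isLocalization_atPrime_isLocalization pc
      (Localization.AtPrime QS) QS
    exact (IsLocalization.under_map_of_isPrime_disjoint pc S ‹Q.IsPrime› disj).symm
  haveI : IsRegularRing Rq := isRegularRing_of_isRegularLocalRing Rq
  haveI : IsRegularRing S := MvPolynomial.isRegularRing_of_isRegularRing Rq
  haveI hregQS : IsRegularLocalRing (Localization.AtPrime QS) :=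
    IsRegularRing.isRegularLocalRing_localization QS
  exact @IsRegularLocalRing.of_ringEquiv (Localization.AtPrime QS) _ hregQS (Localization.AtPrime Q) _
    (IsLocalization.algEquiv Q.primeCompl (Localization.AtPrime QS) (Localization.AtPrime Q)).toRingEquiv

/-- Transport of regularity at a prime along a ring isomorphism `e : A ≃+* A'`:
`A'_{𝔭'}` is regular iff `A_{e⁻¹ 𝔭'}` is. -/
theorem isRegularLocalRing_localization_iff_of_ringEquiv {A A' : Type} [CommRing A] [CommRing A']
    (e : A ≃+* A') (P : Ideal A') [P.IsPrime] :
    IsRegularLocalRing (Localization.AtPrime P) ↔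
      IsRegularLocalRing (Localization.AtPrime (P.comap (e : A →+* A'))) :=
  mem_regularLocus_iff_of_ringEquiv e ⟨P, inferInstance⟩

end PolynomialExtension

/-! ## Local uniformization ascends along purely transcendental extensions -/

section Ascent

variable {k K : Type} [Field k] [Field K] [Algebra k K]

/-- `K` is algebraic over `A₀[y']` as soon as `K = k(A₀, y)` and `y'ᵢ ∈ {yᵢ, yᵢ⁻¹}`. -/
theorem isAlgebraic_adjoin_of_eq_or_eq_inv (A₀ : Subalgebra k K) {r : ℕ} {y y' : Fin r → K}
    (hy : ∀ i, y' i = y i ∨ y' i = (y i)⁻¹)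
    (htop : IntermediateField.adjoin k ((A₀ : Set K) ∪ Set.range y) = ⊤) :
    Algebra.IsAlgebraic (Algebra.adjoin A₀ (Set.range y')) K := by
  set B : Subalgebra A₀ K := Algebra.adjoin A₀ (Set.range y') with hB
  -- `k[A₀ ∪ y'] ⊆ B`
  have hA₀B : ∀ a : K, a ∈ A₀ → a ∈ B := fun a ha => by
    have : algebraMap A₀ K ⟨a, ha⟩ ∈ B := B.algebraMap_mem _
    exact this
  have hy'B : ∀ i, y' i ∈ B := fun i => Algebra.subset_adjoin ⟨i, rfl⟩
  have hle : ∀ z : K, z ∈ Algebra.adjoin k ((A₀ : Set K) ∪ Set.range y') → z ∈ B := by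
    intro z hz
    induction hz using Algebra.adjoin_induction with
    | mem w hw =>
      rcases hw with hw | ⟨i, rfl⟩
      · exact hA₀B w hw
      · exact hy'B i
    | algebraMap c => exact hA₀B _ (A₀.algebraMap_mem c)
    | add _ _ _ _ ha hb => exact add_mem ha hb
    | mul _ _ _ _ ha hb => exact mul_mem ha hb
  -- `k(A₀, y') = k(A₀, y) = K`
  have htop' : IntermediateField.adjoin k ((A₀ : Set K) ∪ Set.range y') = ⊤ := by
    apply top_le_iff.mp
    rw [← htop, IntermediateField.adjoin_le_iff]
    set F := IntermediateField.adjoin k ((A₀ : Set K) ∪ Set.range y') with hF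
    have hy'F : ∀ i, y' i ∈ F := fun i =>
      IntermediateField.subset_adjoin k _ (Or.inr ⟨i, rfl⟩)
    rintro z (hz | ⟨i, rfl⟩)
    · exact IntermediateField.subset_adjoin k _ (Or.inl hz)
    · exact mem_of_eq_or_eq_inv hy hy'F i
  refine ⟨fun z => ?_⟩
  have hz : z ∈ IntermediateField.adjoin k ((A₀ : Set K) ∪ Set.range y') := by
    rw [htop']; exact IntermediateField.mem_top
  obtain ⟨a, ha, b, hb, rfl⟩ := IntermediateField.mem_adjoin_iff_div.mp hz
  rw [div_eq_mul_inv]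
  exact (isAlgebraic_algebraMap (⟨a, hle a ha⟩ : B)).mul
    (IsAlgebraic.inv_iff.mpr (isAlgebraic_algebraMap (⟨b, hle b hb⟩ : B)))

/-- **Local uniformization ascends along purely transcendental extensions.** Let `O ⊇ k` be a
valuation ring of `K`, `A₀ ⊆ O` a finitely generated `k`-subalgebra of `K` regular at the centre
`𝔪_O ∩ A₀`, and `y₁, …, y_r ∈ K` with `K = k(A₀, y)` and `trdeg_k A₀ + r ≤ trdeg_k K` (i.e. `y` is
algebraically independent over `Frac A₀` and generates `K` over it).  Then `O` is locally
uniformizable over `k`: with `y'ᵢ ∈ {yᵢ, yᵢ⁻¹} ∩ O`, the model `A₀[y'] ⊆ O` is a polynomial ring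
over `A₀`, and its local ring at the centre of `O` is regular by
`isRegularLocalRing_localization_mvPolynomial` (the centre of `O` on `A₀[y']` lies over the
centre of `O` on `A₀`). -/
theorem isLocallyUniformizable_of_adjoin_model (O : ValuationSubring K)
    (hO : ∀ c : k, algebraMap k K c ∈ O) (A₀ : Subalgebra k K)
    (h₀ : A₀.toSubring ≤ O.toSubring) (hfg : A₀.FG)
    (hreg : IsRegularLocalRing (Localization.AtPrime
      (Ideal.comap (Subring.inclusion h₀) (IsLocalRing.maximalIdeal O))))
    {r : ℕ} (y : Fin r → K)
    (htop : IntermediateField.adjoin k ((A₀ : Set K) ∪ Set.range y) = ⊤)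
    (hdim : Algebra.trdeg k A₀ + r ≤ Algebra.trdeg k K) :
    IsLocallyUniformizable k K O := by
  classical
  -- ### the `O`-adapted Laurent base `y'` over `A₀` is algebraically independent over `A₀`
  obtain ⟨y', hy'O, hy'⟩ := exists_eq_or_eq_inv_mem O y
  haveI : FaithfulSMul k K :=
    (faithfulSMul_iff_algebraMap_injective k K).mpr (algebraMap k K).injective
  haveI : FaithfulSMul A₀ K :=
    (faithfulSMul_iff_algebraMap_injective A₀ K).mpr Subtype.val_injective
  haveI : FaithfulSMul k A₀ :=
    (faithfulSMul_iff_algebraMap_injective k A₀).mpr (algebraMap k A₀).injective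
  haveI : Algebra.FiniteType k A₀ := A₀.fg_iff_finiteType.mp hfg
  haveI halg := isAlgebraic_adjoin_of_eq_or_eq_inv A₀ hy' htop
  have hind : AlgebraicIndependent A₀ y' := by
    refine (Algebra.IsAlgebraic.isTranscendenceBasis_of_le_trdeg_of_finite A₀ y' ?_).1
    rw [Cardinal.mk_fin]
    have hfin : Algebra.trdeg k A₀ < Cardinal.aleph0 := trdeg_lt_aleph0
    have h := trdeg_add_eq k A₀ (A := K)
    rw [← h, add_comm (Algebra.trdeg k A₀) (r : Cardinal), add_comm (Algebra.trdeg k A₀)] at hdim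
    exact (Cardinal.add_le_add_iff_of_lt_aleph0 hfin).mp hdim
  -- ### the model `B' = k[s₀, y'] = A₀[y']`
  obtain ⟨s₀, rfl⟩ := hfg
  set B : Subalgebra (Algebra.adjoin k (s₀ : Set K)) K :=
    Algebra.adjoin (Algebra.adjoin k (s₀ : Set K)) (Set.range y') with hB
  set B' : Subalgebra k K := Algebra.adjoin k ((s₀ : Set K) ∪ Set.range y') with hB'
  have hBB' : B' = B.restrictScalars k := Algebra.adjoin_union_eq_adjoin_adjoin k _ _
  have e : B'.toSubring = B.toSubring := by rw [hBB']; rfl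
  have hy'B' : ∀ i, y' i ∈ B' := fun i => Algebra.subset_adjoin (Or.inr ⟨i, rfl⟩)
  have hs₀B' : (s₀ : Set K) ⊆ B' := fun z hz => Algebra.subset_adjoin (Or.inl hz)
  have hA₀B' : Algebra.adjoin k (s₀ : Set K) ≤ B' := Algebra.adjoin_le hs₀B'
  -- `B' ⊆ O`
  have hB'O : B'.toSubring ≤ O.toSubring := by
    let Oalg : Subalgebra k K := { O.toSubring with algebraMap_mem' := hO }
    change B' ≤ Oalg
    refine Algebra.adjoin_le ?_
    rintro z (hz | ⟨i, rfl⟩)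
    · exact h₀ (Algebra.subset_adjoin hz : z ∈ Algebra.adjoin k (s₀ : Set K))
    · exact hy'O i
  have hBO : B.toSubring ≤ O.toSubring := e ▸ hB'O
  refine ⟨B', hB'O, ?_, ?_, ?_⟩
  · -- `B'` is finitely generated
    refine ⟨s₀ ∪ Finset.univ.image y', ?_⟩
    rw [Finset.coe_union, Finset.coe_image, Finset.coe_univ, Set.image_univ]
  · -- `Frac B' = K`
    apply isFractionRing_of_adjoin_eq_top
    apply top_le_iff.mp
    rw [← htop, IntermediateField.adjoin_le_iff]
    set F := IntermediateField.adjoin k ((B' : Subalgebra k K) : Set K) with hF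
    have hB'F : ∀ z ∈ B', z ∈ F := fun z hz => IntermediateField.subset_adjoin k _ hz
    rintro z (hz | ⟨i, rfl⟩)
    · exact hB'F z (hA₀B' hz)
    · exact mem_of_eq_or_eq_inv hy' (fun j => hB'F _ (hy'B' j)) i
  · -- ### regularity at the centre: transport to `A₀[X] = MvPolynomial (Fin r) A₀`
    refine isRegularLocalRing_centre_of_toSubring_eq O B' hB'O hBO e ?_
    -- the centre `𝔔` of `O` on `B` and its preimage `Q` in the polynomial ring
    set 𝔔 : Ideal B := Ideal.comap (Subring.inclusion hBO) (IsLocalRing.maximalIdeal O) with h𝔔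
    change IsRegularLocalRing (Localization.AtPrime 𝔔)
    let eB : MvPolynomial (Fin r) (Algebra.adjoin k (s₀ : Set K)) ≃+* B := hind.aevalEquiv.toRingEquiv
    haveI : 𝔔.IsPrime := Ideal.comap_isPrime _ _
    refine (isRegularLocalRing_localization_iff_of_ringEquiv eB 𝔔).mpr ?_
    set Q : Ideal (MvPolynomial (Fin r) (Algebra.adjoin k (s₀ : Set K))) :=
      𝔔.comap (eB : MvPolynomial (Fin r) (Algebra.adjoin k (s₀ : Set K)) →+* B) with hQ
    haveI : Q.IsPrime := Ideal.comap_isPrime _ _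
    apply isRegularLocalRing_localization_mvPolynomial Q
    -- `Q ∩ A₀` is the centre of `O` on `A₀`
    have hQC : Q.comap (MvPolynomial.C : Algebra.adjoin k (s₀ : Set K) →+*
        MvPolynomial (Fin r) (Algebra.adjoin k (s₀ : Set K))) =
        Ideal.comap (Subring.inclusion h₀) (IsLocalRing.maximalIdeal O) := by
      ext a
      have hval : (Subring.inclusion hBO (eB (MvPolynomial.C a)) : K) = (a : K) := by
        change algebraMap B K (hind.aevalEquiv (MvPolynomial.C a)) = (a : K)
        rw [hind.algebraMap_aevalEquiv, MvPolynomial.aeval_C]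
        rfl
      have hval' : Subring.inclusion hBO (eB (MvPolynomial.C a)) = Subring.inclusion h₀ a :=
        Subtype.ext hval
      simp only [Ideal.mem_comap, hQ, h𝔔, RingHom.coe_coe]
      rw [hval']
    exact isRegularLocalRing_localization_atPrime_congr hQC.symm hreg

end Ascent

end Summit.ResolutionOfSingularities.ResolutionOfSingularities.Theorems.Lupi
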